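import Mathlib
import Literature.Combinatorics.Optimization.BinaryCspLpHardnessFromMaxCut
import Literature.Combinatorics.Optimization.LpFormulationReductions
import Literature.Combinatorics.Optimization.CspSdpFormulationComplexity
import HarnessLib

/-!
# Binary CSPs: LP and SDP formulation complexity by reduction from MaxCUT (Braun–Pokutta–Zink 2015, §6.2–6.3, `fc` currency)

Companion of `BinaryCspLpHardnessFromMaxCut.lean` (which proves the reductions of [BraunPokuttaZink2015, §6.2–6.3] —
Cor. 6.4 Max-2-CSP / Max-2-CONJSAT, Cor. 6.6 Max-2-SAT, Cor. 6.8 MaxDICUT — in the Kothari–Meka–Raghavendra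
LP-relaxation and Lee–Raghavendra–Steurer subspace models).  This file states the consequences in the paper's OWN
currency, LP and SDP FORMULATION complexity of the optimization problems (`LPFormulation` / `SDPFormulation` of the
Max-problem `cspProblem 2 N 𝒫₂ c s`, Defs. 2.5/2.8 of the paper = the tree's `LpFormulationReductions.lean` /
`SymmetricSDPMatching.lean`), all PROVED, no named facts:

* `cspAffineReduction` — a same-variable affine CSP reduction (`ℑ = aℑ* + θ`, `γ = id`) IS an affine reduction
  (Def. 4.1 / Cor. 4.4) between the problems `cspProblem`; `hasNonnegFactorization_of_cspAffine`,
  `hasPsdFactorization_of_cspAffine` — Prop. 4.2: nonnegative / psd rank of the slack matrices (`cspMatrix`) travel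
  back with `+1`.
* The chain Max-3-XOR ← MaxCUT ← binary CSP at matrix level: `hasNonnegFactorization_xor_of_cut` (the gadget
  reduction `xorCutCspReduction` of `MaxCutCspHardness.lean`, [BraunPokuttaRoy2016, Thm. 7.1] repaired),
  `hasNonnegFactorization_cut_of_incl/_sat/_dicut` and the psd versions.
* **`fc_LP`, unconditional** (input: the tree's `maxKXor_nnr`, i.e. [ChanEtAl2016] × [Schoenebeck2008]): for every
  `ε > 0` and `C`, for all large `n` and `N = cutVars n = 1 + 2n + 36n³`, there is NO LP formulation of size `≤ N^C` of
  `cspProblem 2 N 𝒫₂ c s` at: `((17−2ε)/21, (16+2ε)/21)` for any `𝒫₂ ∋ (≠)` (`binaryCsp_lpFormulation_poly_of_neq`,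
  Cor. 6.4); `((19−ε)/21, (37+2ε)/42)` for Max-2-SAT (`maxTwoSat_lpFormulation_poly`, Cor. 6.6; ratio `→ 37/38`);
  `((17−2ε)/42, (8+ε)/21)` for MaxDICUT and Max-2-CONJSAT (`maxDicut_lpFormulation_poly`,
  `maxTwoConjSat_lpFormulation_poly`, Cor. 6.8 / 6.4; ratio `→ 16/17`).
* **`fc_SDP`, unconditional** (input: `maxCut_subspace_quasipoly`, i.e. [LeeRaghavendraSteurer2015] × [Schoenebeck2008] ×
  the gadgets; `sdpFormulation_quasipoly_cutVars` does the `(d+1)²` bookkeeping along `N = cutVars n`): `γ > 0` with NO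
  SDP formulation of size `≤ N^{γ log N/loglog N}`, for `1/2 < s < c < 1` and all large `n`, of `cspProblem 2 N 𝒫₂` at
  `((15+2c)/21, (15+2s)/21)` (`𝒫₂ ∋ (≠)`), `((18+c)/21, (18+s)/21)` (Max-2-SAT: `maxTwoSat_sdpFormulation_quasipoly`),
  `((15+2c)/42, (15+2s)/42)` (MaxDICUT / Max-2-CONJSAT: `maxDicut_sdpFormulation_quasipoly`,
  `maxTwoConjSat_sdpFormulation_quasipoly`).

Printed (for comparison; see the companion file's docstring): `fc(MaxSAT2, 1−ε, 3/4+ε)`, `fc(MaxDICUT, 1/2−ε, 1/4+ε)`,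
`fc(Max-2-CSP, 1−ε, 1/2+ε)`, `fc(Max-2-CONJSAT, 1/2−ε, 1/4+ε) ≥ n^{Ω(log n/loglog n)}` for infinitely many `n`, from the
MaxCUT base `(1−ε, 1/2+ε)` of [CLRS13]/[CMM09] (conditional in the tree: `CharikarMakarychevMakarychev2009_maxCutSA`; the
conditional LP-relaxation versions with the printed constants are in the companion file), and the SDP clauses there
are conditional on the paper's open Conjecture (MaxCUT SDP-hard at `c_GW`).  The constants here are the UNCONDITIONAL
ones the tree's inputs give; the size regimes are polynomial (`N^C`, every `C`) for LPs and quasi-polynomial for SDPs.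
-/

noncomputable section

open Finset Real Filter

namespace Literature.Combinatorics.Optimization

/-! ### Same-variable affine CSP reductions as reductions between the problems `cspProblem` -/

section Affine

variable {n k k' : ℕ} {P₁ : Set ((Fin k → Bool) → Bool)} {P₂ : Set ((Fin k' → Bool) → Bool)}

/-- **A same-variable affine CSP reduction is an affine reduction of Max-problems** (BPZ Def. 4.1 / BPR Def. 3.1
between `cspProblem k n 𝒫₁ c₁ s₁` and `cspProblem k' n 𝒫₂ c₂ s₂`): instance map `ℑ ↦ ℑ*`, solution map the identity,
`c₁ − ℑ(x) = a·(c₂ − ℑ*(x))` from `ℑ = aℑ* + θ` and `c₁ = a c₂ + θ`.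
[cite: BraunPokuttaZink2015, Def. 4.1 and Cor. 4.4] -/
def cspAffineReduction (inst : CSPInstance k n P₁ → CSPInstance k' n P₂) {a θ : ℝ} (ha : 0 ≤ a)
    (hval : ∀ (I : CSPInstance k n P₁) (x : Fin n → Bool), I.val x = a * (inst I).val x + θ)
    {c₁ s₁ c₂ s₂ : ℝ} (hc : c₁ = a * c₂ + θ)
    (hsound : ∀ I : CSPInstance k n P₁, I.OptLE s₁ → (inst I).OptLE s₂) :
    (cspProblem k n P₁ c₁ s₁).Reduction (cspProblem k' n P₂ c₂ s₂) :=
  MaxProblem.Reduction.affine inst id (fun _ => a) (fun _ => 0) (fun _ => ha) (fun _ => le_rfl)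
    (fun I x => by simp only [cspProblem_C, cspProblem_val, hval I x, hc, id]; ring)
    (fun I hI => (cspProblem_sound_iff _).2 (hsound I ((cspProblem_sound_iff I).1 hI)))

/-- Nonnegative rank travels back along a same-variable affine CSP reduction (`+1`).
[cite: BraunPokuttaZink2015, Prop. 4.2 (LP clause)] -/
theorem hasNonnegFactorization_of_cspAffine (inst : CSPInstance k n P₁ → CSPInstance k' n P₂) {a θ : ℝ}
    (ha : 0 ≤ a) (hval : ∀ (I : CSPInstance k n P₁) (x : Fin n → Bool), I.val x = a * (inst I).val x + θ)
    {c₁ s₁ c₂ s₂ : ℝ} (hc : c₁ = a * c₂ + θ)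
    (hsound : ∀ I : CSPInstance k n P₁, I.OptLE s₁ → (inst I).OptLE s₂) {r : ℕ}
    (h : HasNonnegFactorization (cspMatrix k' n P₂ c₂ s₂) r) :
    HasNonnegFactorization (cspMatrix k n P₁ c₁ s₁) (r + 1) :=
  hasNonnegFactorization_cspProblem_iff.1
    ((cspAffineReduction inst ha hval hc hsound).hasNonnegFactorization_slackMatrix_affine (fun _ => a)
      (fun _ => 0) (fun _ _ => rfl) (fun _ _ => rfl) (hasNonnegFactorization_cspProblem_iff.2 h))

/-- Psd rank travels back along a same-variable affine CSP reduction (`+1`).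
[cite: BraunPokuttaZink2015, Prop. 4.2 (SDP clause)] -/
theorem hasPsdFactorization_of_cspAffine (inst : CSPInstance k n P₁ → CSPInstance k' n P₂) {a θ : ℝ}
    (ha : 0 ≤ a) (hval : ∀ (I : CSPInstance k n P₁) (x : Fin n → Bool), I.val x = a * (inst I).val x + θ)
    {c₁ s₁ c₂ s₂ : ℝ} (hc : c₁ = a * c₂ + θ)
    (hsound : ∀ I : CSPInstance k n P₁, I.OptLE s₁ → (inst I).OptLE s₂) {r : ℕ}
    (h : HasPsdFactorization (cspMatrix k' n P₂ c₂ s₂) r) :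
    HasPsdFactorization (cspMatrix k n P₁ c₁ s₁) (r + 1) :=
  hasPsdFactorization_cspProblem_iff.1
    ((cspAffineReduction inst ha hval hc hsound).hasPsdFactorization_slackMatrix_affine (fun _ => a)
      (fun _ => 0) (fun _ _ => rfl) (fun _ _ => rfl) (hasPsdFactorization_cspProblem_iff.2 h))

end Affine

/-! ### The chain Max-3-XOR → MaxCUT → binary CSP at the level of nonnegative rank -/

section Chain

variable {n : ℕ} {P₂ : Set ((Fin 2 → Bool) → Bool)} {c s : ℝ} {r : ℕ}

/-- Max-3-XOR ← MaxCUT (the gadget reduction `xorCutCspReduction` of `MaxCutCspHardness.lean`), nonnegative rank.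
[cite: BraunPokuttaRoy2016, Thm. 3.2 (LP clause) and Thm. 7.1 (arXiv v3)] -/
theorem hasNonnegFactorization_xor_of_cut
    (h : HasNonnegFactorization (cspMatrix 2 (cutVars n) maxCutPreds ((15 + 2 * c) / 21) ((15 + 2 * s) / 21)) r) :
    HasNonnegFactorization (cspMatrix 3 n (literalClosure (xorK 3)) c s) (r + 1) :=
  hasNonnegFactorization_cspProblem_iff.1 ((xorCutCspReduction n c s).hasNonnegFactorization_slackMatrix_affine
    (fun _ => 21 / 2) (fun _ => 0) (fun _ _ => rfl) (fun _ _ => rfl) (hasNonnegFactorization_cspProblem_iff.2 h))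

/-- MaxCUT ← binary CSP containing `≠` (Cor. 6.4 reduction), nonnegative rank. [cite: BraunPokuttaZink2015, Cor. 6.4 and Prop. 4.2] -/
theorem hasNonnegFactorization_cut_of_incl (hP : neqPred ∈ P₂)
    (h : HasNonnegFactorization (cspMatrix 2 n P₂ c s) r) :
    HasNonnegFactorization (cspMatrix 2 n maxCutPreds c s) (r + 1) :=
  hasNonnegFactorization_of_cspAffine (inclInst hP) zero_le_one (inclInst_val hP) (by ring)
    (fun I hI => inclInst_optLE hP I hI) h

/-- MaxCUT ← Max-2-SAT (Cor. 6.6 reduction), nonnegative rank. [cite: BraunPokuttaZink2015, Cor. 6.6 and Prop. 4.2] -/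
theorem hasNonnegFactorization_cut_of_sat (h0 : clausePred (fun _ => false) ∈ P₂)
    (h1 : clausePred (fun _ => true) ∈ P₂)
    (h : HasNonnegFactorization (cspMatrix 2 n P₂ ((1 + c) / 2) ((1 + s) / 2)) r) :
    HasNonnegFactorization (cspMatrix 2 n maxCutPreds c s) (r + 1) :=
  hasNonnegFactorization_of_cspAffine (satInst h0 h1) zero_le_two (satInst_val h0 h1) (by ring)
    (fun I hI => satInst_optLE h0 h1 I hI) h

/-- MaxCUT ← MaxDICUT / Max-2-CONJSAT (Cor. 6.8 reduction), nonnegative rank.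
[cite: BraunPokuttaZink2015, Cor. 6.8 and Prop. 4.2] -/
theorem hasNonnegFactorization_cut_of_dicut (hP : dicutPred ∈ P₂)
    (h : HasNonnegFactorization (cspMatrix 2 n P₂ (c / 2) (s / 2)) r) :
    HasNonnegFactorization (cspMatrix 2 n maxCutPreds c s) (r + 1) :=
  hasNonnegFactorization_of_cspAffine (dicutInst hP) zero_le_two (dicutInst_val hP) (by ring)
    (fun I hI => dicutInst_optLE hP I hI) h

/-- The same three transfers for psd rank. [cite: BraunPokuttaZink2015, Cor. 6.4, Cor. 6.6, Cor. 6.8 and Prop. 4.2 (SDP clauses)] -/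
theorem hasPsdFactorization_cut_of_incl (hP : neqPred ∈ P₂) (h : HasPsdFactorization (cspMatrix 2 n P₂ c s) r) :
    HasPsdFactorization (cspMatrix 2 n maxCutPreds c s) (r + 1) :=
  hasPsdFactorization_of_cspAffine (inclInst hP) zero_le_one (inclInst_val hP) (by ring)
    (fun I hI => inclInst_optLE hP I hI) h

/-- Psd rank, Max-2-SAT. [cite: BraunPokuttaZink2015, Cor. 6.6 and Prop. 4.2 (SDP clause)] -/
theorem hasPsdFactorization_cut_of_sat (h0 : clausePred (fun _ => false) ∈ P₂)
    (h1 : clausePred (fun _ => true) ∈ P₂)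
    (h : HasPsdFactorization (cspMatrix 2 n P₂ ((1 + c) / 2) ((1 + s) / 2)) r) :
    HasPsdFactorization (cspMatrix 2 n maxCutPreds c s) (r + 1) :=
  hasPsdFactorization_of_cspAffine (satInst h0 h1) zero_le_two (satInst_val h0 h1) (by ring)
    (fun I hI => satInst_optLE h0 h1 I hI) h

/-- Psd rank, MaxDICUT / Max-2-CONJSAT. [cite: BraunPokuttaZink2015, Cor. 6.8 and Prop. 4.2 (SDP clause)] -/
theorem hasPsdFactorization_cut_of_dicut (hP : dicutPred ∈ P₂)
    (h : HasPsdFactorization (cspMatrix 2 n P₂ (c / 2) (s / 2)) r) :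
    HasPsdFactorization (cspMatrix 2 n maxCutPreds c s) (r + 1) :=
  hasPsdFactorization_of_cspAffine (dicutInst hP) zero_le_two (dicutInst_val hP) (by ring)
    (fun I hI => dicutInst_optLE hP I hI) h

end Chain

/-! ### Size bookkeeping along `N = cutVars n = 1 + 2n + 36n³` -/

section Bookkeeping

/-- For `n ≥ 37` and `R ≤ N^C`: `R + 3 ≤ n^{(8C+4)/2} + 1`. [folklore] -/
private theorem size_le {n R C : ℕ} (hn37 : 37 ≤ n) (hR : (R : ℝ) ≤ ((cutVars n : ℕ) : ℝ) ^ C) :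
    ((R + 3 : ℕ) : ℝ) ≤ (n : ℝ) ^ (((8 * C + 4 : ℕ) : ℝ) / 2) + 1 := by
  have hn0 : (0 : ℝ) < n := by exact_mod_cast lt_of_lt_of_le (by norm_num) hn37
  have hn3 : (0 : ℝ) ≤ (n : ℝ) ^ 3 := by positivity
  have hn37' : (37 : ℝ) ≤ n := by exact_mod_cast hn37
  have hN : ((cutVars n : ℕ) : ℝ) ≤ (n : ℝ) ^ 4 := by
    rw [cutVars_eq]; push_cast
    have h4 : (n : ℝ) ^ 4 = n * n ^ 3 := by ring
    have h37 : 37 * (n : ℝ) ^ 3 ≤ n * n ^ 3 := mul_le_mul_of_nonneg_right hn37' hn3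
    have hsq : (37 : ℝ) * 37 ≤ (n : ℝ) ^ 2 := by nlinarith
    have hcube : (2 : ℝ) * n + 1 ≤ (n : ℝ) ^ 3 := by nlinarith
    rw [h4]; linarith
  have hexp : (((8 * C + 4 : ℕ) : ℝ) / 2) = ((4 * C + 2 : ℕ) : ℝ) := by push_cast; ring
  rw [hexp, Real.rpow_natCast]
  have hRC : (R : ℝ) ≤ (n : ℝ) ^ (4 * C) := by
    refine hR.trans ?_
    calc ((cutVars n : ℕ) : ℝ) ^ C ≤ ((n : ℝ) ^ 4) ^ C := pow_le_pow_left₀ (by positivity) hN C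
      _ = (n : ℝ) ^ (4 * C) := by rw [← pow_mul]
  have hn4 : (4 : ℝ) ≤ (n : ℝ) ^ 2 := by nlinarith
  have hkey : (n : ℝ) ^ (4 * C) * 4 ≤ (n : ℝ) ^ (4 * C) * (n : ℝ) ^ 2 :=
    mul_le_mul_of_nonneg_left hn4 (by positivity)
  have hpow : (n : ℝ) ^ (4 * C + 2) = (n : ℝ) ^ (4 * C) * (n : ℝ) ^ 2 := by rw [pow_add]
  have h1 : (1 : ℝ) ≤ (n : ℝ) ^ (4 * C) := one_le_pow₀ (by linarith)
  push_cast
  rw [hpow]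
  linarith

/-- `N = cutVars n ≥ max(n, 39)` for `n ≥ 1`. [folklore] -/
private theorem le_cutVars (n : ℕ) : n ≤ cutVars n := by
  rw [cutVars_eq]; nlinarith [Nat.zero_le (n ^ 3)]

/-- Bookkeeping (as in `CspSdpFormulationComplexity`): for `N ≥ 16`, `9 ≤ N^{α/3}` and
`d ≤ N^{(α/3) log N/log log N}`: `(d+1)² ≤ N^{α log N/log log N}`. [folklore] -/
private theorem sq_succ_le_rpow {N d : ℕ} (hN : 16 ≤ N) {α : ℝ} (hα : 0 < α) (h9 : (9 : ℝ) ≤ (N : ℝ) ^ (α / 3))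
    (hd : (d : ℝ) ≤ (N : ℝ) ^ (α / 3 * Real.log N / Real.log (Real.log N))) :
    (((d + 1) ^ 2 : ℕ) : ℝ) ≤ (N : ℝ) ^ (α * Real.log N / Real.log (Real.log N)) := by
  have hN0 : (0 : ℝ) < N := by exact_mod_cast lt_of_lt_of_le (by norm_num) hN
  have hN1 : (1 : ℝ) < N := by exact_mod_cast lt_of_lt_of_le (by norm_num) hN
  have hlog : 1 < Real.log N := by
    rw [← Real.exp_lt_exp, Real.exp_log hN0]
    exact lt_of_lt_of_le (lt_trans Real.exp_one_lt_d9 (by norm_num)) (by exact_mod_cast hN : (16 : ℝ) ≤ N)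
  have hll : 0 < Real.log (Real.log N) := Real.log_pos hlog
  have hll_le : Real.log (Real.log N) ≤ Real.log N :=
    (Real.log_le_sub_one_of_pos (by linarith)).trans (by linarith)
  set L : ℝ := Real.log N / Real.log (Real.log N) with hL
  have hL1 : 1 ≤ L := by rw [hL, le_div_iff₀ hll, one_mul]; exact hll_le
  have hexp : ∀ b : ℝ, b * Real.log N / Real.log (Real.log N) = b * L := fun b => by rw [hL]; ring
  rw [hexp] at hd ⊢
  have hmono : ∀ b : ℝ, 0 ≤ b → (N : ℝ) ^ b ≤ (N : ℝ) ^ (b * L) := fun b hb =>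
    Real.rpow_le_rpow_of_exponent_le hN1.le (by nlinarith)
  have hthird : (9 : ℝ) ≤ (N : ℝ) ^ (α / 3 * L) := h9.trans (hmono _ (by positivity))
  have hd2 : ((d : ℝ) + 1) ≤ 3 * (N : ℝ) ^ (α / 3 * L) := by linarith
  push_cast
  calc ((d : ℝ) + 1) ^ 2 ≤ (3 * (N : ℝ) ^ (α / 3 * L)) ^ 2 := pow_le_pow_left₀ (by positivity) hd2 2
    _ = 9 * ((N : ℝ) ^ (α / 3 * L) * (N : ℝ) ^ (α / 3 * L)) := by ring
    _ ≤ (N : ℝ) ^ (α / 3 * L) * ((N : ℝ) ^ (α / 3 * L) * (N : ℝ) ^ (α / 3 * L)) := by gcongr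
    _ = (N : ℝ) ^ (α * L) := by
        rw [← Real.rpow_add hN0, ← Real.rpow_add hN0]; ring_nf

/-- From "no subspace of dimension `≤ N^{γ log N/loglog N}` achieves `(c,s)`" along `N = cutVars n` to "no SDP formulation
of size `≤ N^{(γ/3) log N/loglog N}`" along `N = cutVars n`. [cite: BraunPokuttaRoy2016, Thm. 2.26 (arXiv v3)]
[cite: LeeRaghavendraSteurer2015, Prop. 1.13 (p. 8–9)] -/
theorem sdpFormulation_quasipoly_cutVars {P₂ : Set ((Fin 2 → Bool) → Bool)} {γ c s : ℝ} (hγ : 0 < γ)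
    (h : ∃ n₀ : ℕ, ∀ n : ℕ, n₀ ≤ n → ∀ U : Submodule ℝ ((Fin (cutVars n) → Bool) → ℝ),
      (Module.finrank ℝ U : ℝ) ≤ ((cutVars n : ℕ) : ℝ) ^
        (γ * Real.log (cutVars n) / Real.log (Real.log (cutVars n))) →
      ¬ AchievesApprox P₂ (U : Set ((Fin (cutVars n) → Bool) → ℝ)) c s) :
    ∃ n₀ : ℕ, ∀ n : ℕ, n₀ ≤ n → ∀ d : ℕ,
      (d : ℝ) ≤ ((cutVars n : ℕ) : ℝ) ^ (γ / 3 * Real.log (cutVars n) / Real.log (Real.log (cutVars n))) →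
      IsEmpty (SDPFormulation (cspProblem 2 (cutVars n) P₂ c s) d) := by
  obtain ⟨n₀, H⟩ := h
  -- threshold: `9 ≤ n^{γ/3}` (hence `9 ≤ N^{γ/3}`), `n ≥ 16`
  obtain ⟨n₁, hn₁⟩ : ∃ n₁ : ℕ, ∀ n : ℕ, n₁ ≤ n → (9 : ℝ) ≤ (n : ℝ) ^ (γ / 3) := by
    have ht : Tendsto (fun n : ℕ => (n : ℝ) ^ (γ / 3)) atTop atTop :=
      (tendsto_rpow_atTop (by positivity)).comp tendsto_natCast_atTop_atTop
    obtain ⟨n₁, hn₁⟩ := eventually_atTop.1 (ht.eventually_ge_atTop 9)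
    exact ⟨n₁, hn₁⟩
  refine ⟨max n₀ (max n₁ 16), fun n hn d hd => isEmpty_sdpFormulation_csp fun U hU => ?_⟩
  have hn₀ : n₀ ≤ n := le_trans (le_max_left _ _) hn
  have hn1 : n₁ ≤ n := le_trans ((le_max_left _ _).trans (le_max_right _ _)) hn
  have hn16 : 16 ≤ n := le_trans ((le_max_right _ _).trans (le_max_right _ _)) hn
  have hN16 : 16 ≤ cutVars n := hn16.trans (le_cutVars n)
  have h9 : (9 : ℝ) ≤ ((cutVars n : ℕ) : ℝ) ^ (γ / 3) :=
    (hn₁ n hn1).trans (Real.rpow_le_rpow (by positivity) (by exact_mod_cast le_cutVars n) (by positivity))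
  refine H n hn₀ U (le_trans ?_ (sq_succ_le_rpow hN16 hγ h9 hd))
  exact_mod_cast hU

end Bookkeeping

/-! ### LP formulation complexity (`fc_LP`), unconditional -/

section LP

variable {P₂ : Set ((Fin 2 → Bool) → Bool)}

/-- **Max-2-CSP (any binary family containing `≠`), LP formulations, unconditional:** for `ε > 0` and `C`, for all
large `n`, the problem `cspProblem 2 N 𝒫₂ ((17−2ε)/21) ((16+2ε)/21)` on `N = cutVars n` variables has no LP
formulation (BPZ Def. 2.5) of size `≤ N^C`. [cite: BraunPokuttaZink2015, Cor. 6.4 (LP clause, reduction) with the Max-3-XOR input of `maxKXor_nnr`] -/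
theorem binaryCsp_lpFormulation_poly_of_neq (hP : neqPred ∈ P₂) {ε : ℝ} (hε : 0 < ε) (C : ℕ) :
    ∃ n₀ : ℕ, ∀ n : ℕ, n₀ ≤ n → ∀ R : ℕ, (R : ℝ) ≤ ((cutVars n : ℕ) : ℝ) ^ C →
      IsEmpty (LPFormulation (cspProblem 2 (cutVars n) P₂ ((17 - 2 * ε) / 21) ((16 + 2 * ε) / 21)) R) := by
  obtain ⟨n₀, H⟩ := maxKXor_nnr (k := 3) le_rfl hε (d := 8 * C + 4) (by omega)
  refine ⟨max n₀ 37, fun n hn R hR => LPFormulation.isEmpty_of_not_hasNonnegFactorization fun h => ?_⟩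
  have hn₀ : n₀ ≤ n := le_trans (le_max_left _ _) hn
  have hn37 : 37 ≤ n := le_trans (le_max_right _ _) hn
  have h1 : (15 + 2 * (1 - ε)) / 21 = (17 - 2 * ε) / 21 := by ring
  have h2 : (15 + 2 * (1 / 2 + ε)) / 21 = (16 + 2 * ε) / 21 := by ring
  rw [← h1, ← h2] at h
  exact H n hn₀ (R + 1 + 1 + 1) (by simpa [add_assoc] using size_le hn37 hR)
    (hasNonnegFactorization_xor_of_cut (hasNonnegFactorization_cut_of_incl hP
      (hasNonnegFactorization_cspProblem_iff.1 h)))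

/-- **Max-2-SAT, LP formulations, unconditional** (any binary family containing the clauses `y_0 ∨ y_1`, `ȳ_0 ∨ ȳ_1`):
no LP formulation of size `≤ N^C` of `cspProblem 2 N 𝒫₂ ((19−ε)/21) ((37+2ε)/42)`, `N = cutVars n`, all large `n`.
[cite: BraunPokuttaZink2015, Cor. 6.6 (LP clause, reduction) with the Max-3-XOR input of `maxKXor_nnr`] -/
theorem binaryCsp_lpFormulation_poly_of_clauses (h0 : clausePred (fun _ => false) ∈ P₂)
    (h1 : clausePred (fun _ => true) ∈ P₂) {ε : ℝ} (hε : 0 < ε) (C : ℕ) :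
    ∃ n₀ : ℕ, ∀ n : ℕ, n₀ ≤ n → ∀ R : ℕ, (R : ℝ) ≤ ((cutVars n : ℕ) : ℝ) ^ C →
      IsEmpty (LPFormulation (cspProblem 2 (cutVars n) P₂ ((19 - ε) / 21) ((37 + 2 * ε) / 42)) R) := by
  obtain ⟨n₀, H⟩ := maxKXor_nnr (k := 3) le_rfl hε (d := 8 * C + 4) (by omega)
  refine ⟨max n₀ 37, fun n hn R hR => LPFormulation.isEmpty_of_not_hasNonnegFactorization fun h => ?_⟩
  have hn₀ : n₀ ≤ n := le_trans (le_max_left _ _) hn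
  have hn37 : 37 ≤ n := le_trans (le_max_right _ _) hn
  have e1 : (1 + (15 + 2 * (1 - ε)) / 21) / 2 = (19 - ε) / 21 := by ring
  have e2 : (1 + (15 + 2 * (1 / 2 + ε)) / 21) / 2 = (37 + 2 * ε) / 42 := by ring
  rw [← e1, ← e2] at h
  exact H n hn₀ (R + 1 + 1 + 1) (by simpa [add_assoc] using size_le hn37 hR)
    (hasNonnegFactorization_xor_of_cut (hasNonnegFactorization_cut_of_sat h0 h1
      (hasNonnegFactorization_cspProblem_iff.1 h)))

/-- **Max-2-SAT, LP formulations, unconditional.** [cite: BraunPokuttaZink2015, Cor. 6.6 (LP clause, reduction) with the Max-3-XOR input of `maxKXor_nnr`] -/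
theorem maxTwoSat_lpFormulation_poly {ε : ℝ} (hε : 0 < ε) (C : ℕ) :
    ∃ n₀ : ℕ, ∀ n : ℕ, n₀ ≤ n → ∀ R : ℕ, (R : ℝ) ≤ ((cutVars n : ℕ) : ℝ) ^ C →
      IsEmpty (LPFormulation (cspProblem 2 (cutVars n) (maxKSatPreds 2) ((19 - ε) / 21) ((37 + 2 * ε) / 42)) R) :=
  binaryCsp_lpFormulation_poly_of_clauses (clausePred_mem _) (clausePred_mem _) hε C

/-- **MaxDICUT / Max-2-CONJSAT (any binary family containing `¬y_0 ∧ y_1`), LP formulations, unconditional:** no LP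
formulation of size `≤ N^C` of `cspProblem 2 N 𝒫₂ ((17−2ε)/42) ((8+ε)/21)`, `N = cutVars n`, all large `n`.
[cite: BraunPokuttaZink2015, Cor. 6.8 and Cor. 6.4 (LP clauses, reductions) with the Max-3-XOR input of `maxKXor_nnr`] -/
theorem binaryCsp_lpFormulation_poly_of_dicut (hP : dicutPred ∈ P₂) {ε : ℝ} (hε : 0 < ε) (C : ℕ) :
    ∃ n₀ : ℕ, ∀ n : ℕ, n₀ ≤ n → ∀ R : ℕ, (R : ℝ) ≤ ((cutVars n : ℕ) : ℝ) ^ C →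
      IsEmpty (LPFormulation (cspProblem 2 (cutVars n) P₂ ((17 - 2 * ε) / 42) ((8 + ε) / 21)) R) := by
  obtain ⟨n₀, H⟩ := maxKXor_nnr (k := 3) le_rfl hε (d := 8 * C + 4) (by omega)
  refine ⟨max n₀ 37, fun n hn R hR => LPFormulation.isEmpty_of_not_hasNonnegFactorization fun h => ?_⟩
  have hn₀ : n₀ ≤ n := le_trans (le_max_left _ _) hn
  have hn37 : 37 ≤ n := le_trans (le_max_right _ _) hn
  have e1 : (15 + 2 * (1 - ε)) / 21 / 2 = (17 - 2 * ε) / 42 := by ring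
  have e2 : (15 + 2 * (1 / 2 + ε)) / 21 / 2 = (8 + ε) / 21 := by ring
  rw [← e1, ← e2] at h
  exact H n hn₀ (R + 1 + 1 + 1) (by simpa [add_assoc] using size_le hn37 hR)
    (hasNonnegFactorization_xor_of_cut (hasNonnegFactorization_cut_of_dicut hP
      (hasNonnegFactorization_cspProblem_iff.1 h)))

/-- **MaxDICUT, LP formulations, unconditional.** [cite: BraunPokuttaZink2015, Cor. 6.8 (LP clause, reduction) with the Max-3-XOR input of `maxKXor_nnr`] -/
theorem maxDicut_lpFormulation_poly {ε : ℝ} (hε : 0 < ε) (C : ℕ) :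
    ∃ n₀ : ℕ, ∀ n : ℕ, n₀ ≤ n → ∀ R : ℕ, (R : ℝ) ≤ ((cutVars n : ℕ) : ℝ) ^ C →
      IsEmpty (LPFormulation (cspProblem 2 (cutVars n) dicutPreds ((17 - 2 * ε) / 42) ((8 + ε) / 21)) R) :=
  binaryCsp_lpFormulation_poly_of_dicut (P₂ := dicutPreds) (Set.mem_singleton _) hε C

/-- **Max-2-CONJSAT, LP formulations, unconditional.** [cite: BraunPokuttaZink2015, Cor. 6.4 (Max-2-CONJSAT, LP clause, reduction) with the Max-3-XOR input of `maxKXor_nnr`] -/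
theorem maxTwoConjSat_lpFormulation_poly {ε : ℝ} (hε : 0 < ε) (C : ℕ) :
    ∃ n₀ : ℕ, ∀ n : ℕ, n₀ ≤ n → ∀ R : ℕ, (R : ℝ) ≤ ((cutVars n : ℕ) : ℝ) ^ C →
      IsEmpty (LPFormulation (cspProblem 2 (cutVars n) (literalClosure andTwo) ((17 - 2 * ε) / 42)
        ((8 + ε) / 21)) R) :=
  binaryCsp_lpFormulation_poly_of_dicut dicutPred_mem_literalClosure hε C

end LP

/-! ### SDP formulation complexity (`fc_SDP`), unconditional -/

section SDP

variable {P₂ : Set ((Fin 2 → Bool) → Bool)}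

/-- **Max-2-CSP (containing `≠`), SDP formulations, unconditional:** `γ > 0` such that for `1/2 < s < c < 1` and all
large `n`, `cspProblem 2 N 𝒫₂ ((15+2c)/21) ((15+2s)/21)` has no SDP formulation of size `≤ N^{γ log N/loglog N}`
(`N = cutVars n`). [cite: BraunPokuttaZink2015, Cor. 6.4 (SDP clause, reduction) with the MaxCUT input of `maxCut_subspace_quasipoly`] -/
theorem binaryCsp_sdpFormulation_quasipoly_of_neq (hP : neqPred ∈ P₂) :
    ∃ γ : ℝ, 0 < γ ∧ ∀ s : ℝ, 1 / 2 < s → ∀ c : ℝ, s < c → c < 1 →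
      ∃ n₀ : ℕ, ∀ n : ℕ, n₀ ≤ n → ∀ d : ℕ,
        (d : ℝ) ≤ ((cutVars n : ℕ) : ℝ) ^ (γ * Real.log (cutVars n) / Real.log (Real.log (cutVars n))) →
        IsEmpty (SDPFormulation (cspProblem 2 (cutVars n) P₂ ((15 + 2 * c) / 21) ((15 + 2 * s) / 21)) d) := by
  obtain ⟨γ, hγ, H⟩ := binaryCsp_subspace_quasipoly_of_neq hP
  exact ⟨γ / 3, by positivity, fun s hs c hsc hc1 => sdpFormulation_quasipoly_cutVars hγ (H s hs c hsc hc1)⟩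

/-- **Max-2-SAT, SDP formulations, unconditional** (ratio `→ 37/38`): no SDP formulation of size `≤ N^{γ log N/loglog N}`
of `cspProblem 2 N 𝒫₂ ((18+c)/21) ((18+s)/21)` for binary families containing the two clauses.
[cite: BraunPokuttaZink2015, Cor. 6.6 (SDP clause, reduction) with the MaxCUT input of `maxCut_subspace_quasipoly`] -/
theorem binaryCsp_sdpFormulation_quasipoly_of_clauses (h0 : clausePred (fun _ => false) ∈ P₂)
    (h1 : clausePred (fun _ => true) ∈ P₂) :
    ∃ γ : ℝ, 0 < γ ∧ ∀ s : ℝ, 1 / 2 < s → ∀ c : ℝ, s < c → c < 1 →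
      ∃ n₀ : ℕ, ∀ n : ℕ, n₀ ≤ n → ∀ d : ℕ,
        (d : ℝ) ≤ ((cutVars n : ℕ) : ℝ) ^ (γ * Real.log (cutVars n) / Real.log (Real.log (cutVars n))) →
        IsEmpty (SDPFormulation (cspProblem 2 (cutVars n) P₂ ((18 + c) / 21) ((18 + s) / 21)) d) := by
  obtain ⟨γ, hγ, H⟩ := binaryCsp_subspace_quasipoly_of_clauses h0 h1
  exact ⟨γ / 3, by positivity, fun s hs c hsc hc1 => sdpFormulation_quasipoly_cutVars hγ (H s hs c hsc hc1)⟩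

/-- **Max-2-SAT, SDP formulations, unconditional.** [cite: BraunPokuttaZink2015, Cor. 6.6 (SDP clause, reduction) with the MaxCUT input of `maxCut_subspace_quasipoly`] -/
theorem maxTwoSat_sdpFormulation_quasipoly :
    ∃ γ : ℝ, 0 < γ ∧ ∀ s : ℝ, 1 / 2 < s → ∀ c : ℝ, s < c → c < 1 →
      ∃ n₀ : ℕ, ∀ n : ℕ, n₀ ≤ n → ∀ d : ℕ,
        (d : ℝ) ≤ ((cutVars n : ℕ) : ℝ) ^ (γ * Real.log (cutVars n) / Real.log (Real.log (cutVars n))) →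
        IsEmpty (SDPFormulation (cspProblem 2 (cutVars n) (maxKSatPreds 2) ((18 + c) / 21) ((18 + s) / 21)) d) :=
  binaryCsp_sdpFormulation_quasipoly_of_clauses (clausePred_mem _) (clausePred_mem _)

/-- **MaxDICUT / Max-2-CONJSAT, SDP formulations, unconditional** (ratio `→ 16/17`): no SDP formulation of size
`≤ N^{γ log N/loglog N}` of `cspProblem 2 N 𝒫₂ ((15+2c)/42) ((15+2s)/42)` for binary families containing `¬y_0 ∧ y_1`.
[cite: BraunPokuttaZink2015, Cor. 6.8 and Cor. 6.4 (SDP clauses, reductions) with the MaxCUT input of `maxCut_subspace_quasipoly`] -/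
theorem binaryCsp_sdpFormulation_quasipoly_of_dicut (hP : dicutPred ∈ P₂) :
    ∃ γ : ℝ, 0 < γ ∧ ∀ s : ℝ, 1 / 2 < s → ∀ c : ℝ, s < c → c < 1 →
      ∃ n₀ : ℕ, ∀ n : ℕ, n₀ ≤ n → ∀ d : ℕ,
        (d : ℝ) ≤ ((cutVars n : ℕ) : ℝ) ^ (γ * Real.log (cutVars n) / Real.log (Real.log (cutVars n))) →
        IsEmpty (SDPFormulation (cspProblem 2 (cutVars n) P₂ ((15 + 2 * c) / 42) ((15 + 2 * s) / 42)) d) := by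
  obtain ⟨γ, hγ, H⟩ := binaryCsp_subspace_quasipoly_of_dicut hP
  exact ⟨γ / 3, by positivity, fun s hs c hsc hc1 => sdpFormulation_quasipoly_cutVars hγ (H s hs c hsc hc1)⟩

/-- **MaxDICUT, SDP formulations, unconditional.** [cite: BraunPokuttaZink2015, Cor. 6.8 (SDP clause, reduction) with the MaxCUT input of `maxCut_subspace_quasipoly`] -/
theorem maxDicut_sdpFormulation_quasipoly :
    ∃ γ : ℝ, 0 < γ ∧ ∀ s : ℝ, 1 / 2 < s → ∀ c : ℝ, s < c → c < 1 →
      ∃ n₀ : ℕ, ∀ n : ℕ, n₀ ≤ n → ∀ d : ℕ,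
        (d : ℝ) ≤ ((cutVars n : ℕ) : ℝ) ^ (γ * Real.log (cutVars n) / Real.log (Real.log (cutVars n))) →
        IsEmpty (SDPFormulation (cspProblem 2 (cutVars n) dicutPreds ((15 + 2 * c) / 42) ((15 + 2 * s) / 42)) d) :=
  binaryCsp_sdpFormulation_quasipoly_of_dicut (P₂ := dicutPreds) (Set.mem_singleton _)

/-- **Max-2-CONJSAT, SDP formulations, unconditional.** [cite: BraunPokuttaZink2015, Cor. 6.4 (Max-2-CONJSAT, SDP clause, reduction) with the MaxCUT input of `maxCut_subspace_quasipoly`] -/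
theorem maxTwoConjSat_sdpFormulation_quasipoly :
    ∃ γ : ℝ, 0 < γ ∧ ∀ s : ℝ, 1 / 2 < s → ∀ c : ℝ, s < c → c < 1 →
      ∃ n₀ : ℕ, ∀ n : ℕ, n₀ ≤ n → ∀ d : ℕ,
        (d : ℝ) ≤ ((cutVars n : ℕ) : ℝ) ^ (γ * Real.log (cutVars n) / Real.log (Real.log (cutVars n))) →
        IsEmpty (SDPFormulation (cspProblem 2 (cutVars n) (literalClosure andTwo) ((15 + 2 * c) / 42)
          ((15 + 2 * s) / 42)) d) :=
  binaryCsp_sdpFormulation_quasipoly_of_dicut dicutPred_mem_literalClosure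

end SDP

end Literature.Combinatorics.Optimization

end
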